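import Mathlib
import Summits.PneNP.PneNP.Theses.OneSlice
import Summits.PneNP.PneNP.Theorems.OneSliceSliceTargetSplit
import Summits.PneNP.PneNP.Theorems.OneSliceMonotoneContinuationSamplerExpansion
import Summits.PneNP.PneNP.Theorems.OneSliceMonotoneContinuationTransportMono

/-!
# Route OneSlice, crux `MonotoneContinuation` (stmt-PneNP-18471), line `Sketch_ideator1_r1` (ProfileLine) — stub padMixture_expand

Bookkeeping for the uniform-size padding `y := x ∨ ρ`, `x` of weight `i`, `ρ` of weight `a` (pure double
counting, valid for every real-valued `Φ`). For fixed `x` the sum over `ρ ∈ slice n a` is grouped by the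
landing point `y = x ∨ ρ ⊇ x` (`Finset.sum_fiberwise_of_maps_to`); as edge sets, `x ∨ ρ = y` says exactly
`supp y \ supp x ⊆ supp ρ ⊆ supp y` (`padMixture_join_eq_iff`), so the fibre over a `y` of weight `i + l` is a
squeezed slice of size `C(i, a - l)` for `l ≤ a` and is empty for `l > a` (`padMixture_card_fibre`, through
`stub_transportMono_card_between`). On the other side the level sum `Σ_l Σ_{y ∈ slice (i+l)}` is one sum over
the `y` of weight `≥ i` (`Finset.sum_fiberwise_of_maps_to` along `y ↦ e(y) - i ≤ C(n,2) - i`), and for such `y`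
the neighbourhood `nbhd i y` is the set of weight-`i` vectors `x` with `supp x ⊆ supp y`; the two double sums
over the nested pairs `(x, y)` are then exchanged by `Finset.sum_comm'`.
-/

set_option linter.dupNamespace false -- `Summit.PneNP.PneNP.…`: summit = sub-problem (D-0017)

namespace Summit.PneNP.PneNP.Theorems.MonotoneContinuation

open Literature.Computability.Complexity hiding supp mem_supp
open Finset hiding slice
open Filter hiding mem_sdiff
open Classical
open Summit.PneNP.PneNP.Theorems (binomialWeight_tail_le binomialWeight_sum_range binomialWeight_nonneg
  binomialWeight_variance card_slice)
open Summit.PneNP.PneNP.Theorems.ConstantBand.Negative (Edge thr Central slice)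
open Summit.PneNP.PneNP.Theorems.SingleThreshold.Negative (pc)
open Summit.PneNP.PneNP.Theorems.SliceACZero.Negative (supp mem_supp card_supp supp_injective supp_indicator)
open Summit.PneNP.PneNP.Theorems.SliceTargetSplit (Comp nbhd mem_nbhd transport ind l1 nbhdCard card_nbhd
  card_nbhd_of_le card_nbhd_of_ge choose_mul_nbhdCard nbhdCard_pos sum_slice_sum_nbhd sum_slice_sum_nbhd_left
  supp_subset_of_comp_of_le comp_iff_supp comp_comm ofSet supp_ofSet ofSet_supp edgeCount_ofSet ind_nonneg
  ind_le_one abs_ind_sub_ind l1_triangle l1_comm l1_nonneg transport_nonneg transport_sub)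

noncomputable section

variable {n : ℕ}

/-! ### The fibres of `ρ ↦ x ∨ ρ` -/

/-- The support of a join is the union of the supports. [folklore] -/
theorem padMixture_supp_join (x ρ : Edge n → Bool) : supp (fun e => x e || ρ e) = supp x ∪ supp ρ := by
  ext e
  simp only [mem_supp, mem_union, Bool.or_eq_true]

/-- For `x ⊆ y` (as edge sets), `x ∨ ρ = y` says exactly `y \ x ⊆ ρ ⊆ y`. [folklore] -/
theorem padMixture_join_eq_iff {x y ρ : Edge n → Bool} (hxy : supp x ⊆ supp y) :
    (fun e => x e || ρ e) = y ↔ supp y \ supp x ⊆ supp ρ ∧ supp ρ ⊆ supp y := by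
  rw [← supp_injective.eq_iff, padMixture_supp_join]
  constructor
  · intro h
    refine ⟨fun e he => ?_, fun e he => ?_⟩
    · rw [mem_sdiff, ← h, mem_union] at he
      exact he.1.resolve_left he.2
    · rw [← h, mem_union]
      exact Or.inr he
  · rintro ⟨h1, h2⟩
    refine (union_subset hxy h2).antisymm fun e he => ?_
    rw [mem_union]
    by_cases hx : e ∈ supp x
    · exact Or.inl hx
    · exact Or.inr (h1 (mem_sdiff.2 ⟨he, hx⟩))

/-- **Padding fibres at fixed size.** For `x ⊆ y` (as edge sets), the number of weight-`a` vectors `ρ` with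
`x ∨ ρ = y` is `C(e(x), a - (e(y) - e(x)))` if `e(y) - e(x) ≤ a` and `0` otherwise: such a `ρ` is `y \ x`
together with an arbitrary `(a - (e(y) - e(x)))`-subset of `x`. [folklore] -/
theorem padMixture_card_fibre (a : ℕ) {x y : Edge n → Bool} (hxy : supp x ⊆ supp y) :
    #((slice n a).filter fun ρ => (fun e => x e || ρ e) = y) =
      if edgeCount y - edgeCount x ≤ a then (edgeCount x).choose (a - (edgeCount y - edgeCount x)) else 0 := by
  have hfilter : (slice n a).filter (fun ρ => (fun e => x e || ρ e) = y) =
      (slice n a).filter (fun ρ => supp y \ supp x ⊆ supp ρ ∧ supp ρ ⊆ supp y) :=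
    filter_congr fun ρ _ => padMixture_join_eq_iff hxy
  have hU : #(supp y \ supp x) = edgeCount y - edgeCount x := by
    rw [card_sdiff_of_subset hxy, card_supp, card_supp]
  have hle : edgeCount x ≤ edgeCount y := by
    rw [← card_supp, ← card_supp]
    exact card_le_card hxy
  rw [hfilter]
  split_ifs with h
  · rw [stub_transportMono_card_between sdiff_subset (by rwa [hU]), hU, card_supp, Nat.sub_sub_self hle]
  · rw [card_eq_zero, filter_eq_empty_iff]
    rintro ρ hρ ⟨h1, -⟩
    have h' := card_le_card h1
    rw [hU, card_supp, (mem_filter.1 hρ).2] at h'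
    exact h h'

/-- The sum over `ρ ∈ slice n a` of a function of `x ∨ ρ`, grouped by the landing point `y = x ∨ ρ ⊇ x`:
each `y` is hit `C(e(x), a - (e(y) - e(x)))` times (`0` times if `e(y) - e(x) > a`). [folklore] -/
theorem padMixture_inner (a : ℕ) (Φ : (Edge n → Bool) → (Edge n → Bool) → ℝ) (x : Edge n → Bool) :
    ∑ ρ ∈ slice n a, Φ x (fun e => x e || ρ e) =
      ∑ y ∈ univ.filter (fun y : Edge n → Bool => supp x ⊆ supp y),
        (if edgeCount y - edgeCount x ≤ a then
            (((edgeCount x).choose (a - (edgeCount y - edgeCount x)) : ℕ) : ℝ) else 0) * Φ x y := by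
  rw [← sum_fiberwise_of_maps_to (s := slice n a) (t := univ.filter (fun y : Edge n → Bool => supp x ⊆ supp y))
    (g := fun ρ : Edge n → Bool => fun e => x e || ρ e)]
  · refine sum_congr rfl fun y hy => ?_
    have hxy : supp x ⊆ supp y := (mem_filter.1 hy).2
    calc ∑ ρ ∈ (slice n a) with (fun e => x e || ρ e) = y, Φ x (fun e => x e || ρ e)
        = ∑ ρ ∈ (slice n a) with (fun e => x e || ρ e) = y, Φ x y := by
          refine sum_congr rfl fun ρ hρ => ?_
          have hρy : (fun e => x e || ρ e) = y := (mem_filter.1 hρ).2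
          rw [show Φ x (fun e => x e || ρ e) = Φ x y from congrArg (Φ x) hρy]
      _ = _ := by
          rw [sum_const, nsmul_eq_mul, padMixture_card_fibre a hxy, Nat.cast_ite, Nat.cast_zero]
  · intro ρ _
    rw [mem_filter]
    refine ⟨mem_univ _, fun e he => ?_⟩
    rw [mem_supp] at he ⊢
    rw [he, Bool.true_or]

/-- The slice `i + l` is the fibre of `y ↦ e(y) - i` over `l` among the vectors of weight `≥ i`. [folklore] -/
theorem padMixture_slice_eq_filter (i l : ℕ) :
    (univ.filter (fun y : Edge n → Bool => i ≤ edgeCount y)).filter (fun y => edgeCount y - i = l) =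
      slice n (i + l) := by
  ext y
  simp only [slice, mem_filter, mem_univ, true_and]
  omega

/-! ### The registered stub -/

/-- **PadMixture** (stub `padMixture_expand` of line `Sketch_ideator1_r1`, bridge `MC → flat-above`, U3). With `x`
uniform on the slice `i` and `ρ` uniform of weight `a`, the pair `(x, x ∨ ρ)` expands over the landing levels
`i + l`: every nested pair `(x, y)`, `x` of weight `i` below `y` of weight `i + l` (i.e. `x ∈ nbhd i y`), is
produced by exactly `C(i, a - l)` vectors `ρ` if `l ≤ a` and by none otherwise; `Φ` arbitrary. [folklore] -/
theorem padMixture_expand :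
  ∀ (n i a : ℕ) (Φ : (Edge n → Bool) → (Edge n → Bool) → ℝ),
    ∑ x ∈ slice n i, ∑ ρ ∈ slice n a, Φ x (fun e => x e || ρ e) =
      ∑ l ∈ range (n.choose 2 - i + 1), (if l ≤ a then ((i.choose (a - l) : ℕ) : ℝ) else 0) *
        ∑ y ∈ slice n (i + l), ∑ x ∈ nbhd i y, Φ x y := by
  intro n i a Φ
  -- left: group `ρ` by the landing point `y = x ∨ ρ ⊇ x`
  have lhs : ∑ x ∈ slice n i, ∑ ρ ∈ slice n a, Φ x (fun e => x e || ρ e) =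
      ∑ x ∈ slice n i, ∑ y ∈ univ.filter (fun y : Edge n → Bool => supp x ⊆ supp y),
        (if edgeCount y - i ≤ a then ((i.choose (a - (edgeCount y - i)) : ℕ) : ℝ) else 0) * Φ x y := by
    refine sum_congr rfl fun x hx => ?_
    have hxi : edgeCount x = i := (mem_filter.1 hx).2
    rw [padMixture_inner a Φ x, hxi]
  -- right: one sum over the `y` of weight `≥ i`, the coefficient pushed inside
  have rhs : (∑ l ∈ range (n.choose 2 - i + 1), (if l ≤ a then ((i.choose (a - l) : ℕ) : ℝ) else 0) *
        ∑ y ∈ slice n (i + l), ∑ x ∈ nbhd i y, Φ x y) =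
      ∑ y ∈ univ.filter (fun y : Edge n → Bool => i ≤ edgeCount y), ∑ x ∈ nbhd i y,
        (if edgeCount y - i ≤ a then ((i.choose (a - (edgeCount y - i)) : ℕ) : ℝ) else 0) * Φ x y := by
    calc (∑ l ∈ range (n.choose 2 - i + 1), (if l ≤ a then ((i.choose (a - l) : ℕ) : ℝ) else 0) *
          ∑ y ∈ slice n (i + l), ∑ x ∈ nbhd i y, Φ x y)
        = ∑ l ∈ range (n.choose 2 - i + 1),
            ∑ y ∈ (univ.filter (fun y : Edge n → Bool => i ≤ edgeCount y)) with edgeCount y - i = l,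
              ∑ x ∈ nbhd i y,
                (if edgeCount y - i ≤ a then ((i.choose (a - (edgeCount y - i)) : ℕ) : ℝ) else 0) * Φ x y := by
          refine sum_congr rfl fun l _ => ?_
          rw [mul_sum]
          refine sum_congr (padMixture_slice_eq_filter i l).symm fun y hy => ?_
          rw [mul_sum, (mem_filter.1 hy).2]
      _ = _ := by
          refine sum_fiberwise_of_maps_to (fun y _ => ?_) _
          rw [mem_range, Nat.lt_succ_iff]
          exact Nat.sub_le_sub_right (samplerExpansion_edgeCount_le y) _
  rw [lhs, rhs]
  -- exchange the two sums over the nested pairs `x ⊆ y`, `e(x) = i`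
  refine sum_comm' fun x y => ?_
  simp only [slice, mem_filter, mem_univ, true_and, mem_nbhd]
  constructor
  · rintro ⟨hxi, hxy⟩
    have hle : edgeCount x ≤ edgeCount y := by
      rw [← card_supp, ← card_supp]
      exact card_le_card hxy
    exact ⟨⟨hxi, comp_iff_supp.2 (Or.inl hxy)⟩, by omega⟩
  · rintro ⟨⟨hxi, hc⟩, hiy⟩
    exact ⟨hxi, supp_subset_of_comp_of_le hc (by omega)⟩

end

end Summit.PneNP.PneNP.Theorems.MonotoneContinuation
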